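import Summits.QuantumFields.YangMills.Theorems.UnitScaleTiltProp7OrderedProductExpansion
import Summits.QuantumFields.YangMills.Theorems.UnitScaleTiltProp7HolRatioPerStep
import Literature.MathematicalPhysics.QuantumFieldTheory.Balaban1983to89.BlockAveraging
import HarnessLib

/-!
# Route `UnitScaleTilt`, crux K1 child «MinimiserStabilityRegPr» (stmt-QuantumFields-19200), line «route-R», growth side — THE TRANSPORTED LETTER FAMILY OF A WALK:
# THE HOLONOMY RATIO `U(Γ)·U₀(Γ)^*` IS THE ORDERED PRODUCT `Π_t (1 + Ad_{U₀(Γ_{<t})}Z_t)` OF THE EXACT STEP LETTERS, ITS FIRST ORDER IS `covWalkSum`, AND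
# CONCATENATION OF WALKS IS `Fin.append` OF LETTER FAMILIES (so the three-piece split applies to the (0.4) loop word letter by letter)

Cell `ym3-torus`, twin width seat `ym-routeR-w1` (g3); row (w1-o1′) NAMED by the route-R lead `ym-ust-19200-p1` (g13, bus 2026-08-28T13:33:15Z∕13:37:23Z: «§2
instantiation on ONE symmetric (0.4) word, letters `covStep ∕ stepFactor ∕ covWalkSum`»).  THEOREMS ONLY (0 `def`, 0 `sorry`); `--supports stmt-QuantumFields-19200
--as helper`, count-neutral.  YM₃ on T³ is a ladder rung (R3), not the Clay problem; nothing here claims stub S, row E′, the crux or the gap.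

WHY.  ✓ `Prop7OrderedProductExpansion` (the lead's g10∕g13 file) expands an ORDERED PRODUCT `Π_i(1 + A_i)` of a `Fin`-family to second order (Taylor bounds, pair sum =
half square + half COMMUTATOR sum, mass × oscillation, `commSum_append ∕ commSum_rev_neg`), and ✓ `Prop7WordCommutatorSplit` splits the commutator sum of a word
`F ⧺ S ⧺ rev(−F′)`.  To instantiate this on a lattice walk `Γ = (s_0, …, s_{m−1})` one needs the walk's LETTERS as an explicit family: the `t`-th letter is the step term
transported to the start of the walk by the background holonomy of the first `t` steps, `Λ_t(Z) := U₀(Γ_{<t})·Z(s_t)·U₀(Γ_{<t})^*` (written with `Γ.take t` and `Γ[t]?`, so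
the index is a plain natural number and no definition is introduced).  Three facts make the instantiation literal: (a) with the EXACT step ratio `Z^{ex}_s := u_s·g_s^* − 1`
(`u_s, g_s` the step factors of `U, U₀`) the holonomy ratio is the ordered product, `U(Γ)·U₀(Γ)^* = Π_t (1 + Λ_t(Z^{ex}))` ([Balaban1985Averaging] (56)–(58): the recursion
`D(s·Γ) = Z_s + Ad_{g_s}D(Γ) + Z_s·Ad_{g_s}D(Γ)` of ✓ `Prop7HolRatioPerStep`, resummed); (b) with the first-order step term `covStep` the letter sum is the covariant signed
sum of record, `Σ_t Λ_t(covStep) = covWalkSum` (✓ `BlockAveragingEMLLinearisedBackground.covWalkSum_cons`); (c) the letters of a concatenation `Γ₁ ⧺ Γ₂` are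
`Fin.append` of the letters of `Γ₁` and the `U₀(Γ₁)`-transported letters of `Γ₂` — so ✓ `commSum_append` and ✓ `commSum_threePiece` apply to `walk (emb c₋) (loopWord …) =
walk F ⧺ walk S ⧺ walk (rev F′) ⧺ walk (rev axis)` (✓ `BlockAveraging.walk_append`) block by block.

WHAT IS PROVED (ns `…Theorems.Prop7WordLetters`; any level `j`, any `SU(N)`; `Λ_t(Z)` written out as
`↑(holAt U₀ (Γ.take t)) * ((Γ[t]?).map Z).getD 0 * (↑(holAt U₀ (Γ.take t)))^*`, any step-letter map `Z : LStep P j → M_N(ℂ)`).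
* §1 `letter_cons_zero`, `letter_cons_succ` (the letters of `s :: Γ`: `Z s`, then `Ad_{g_s}` of the letters of `Γ`), ★ `sum_letter_eq_covWalkSum`
  (`Σ_{t<|Γ|} Λ_t(covStep U₀ Y) = covWalkSum U₀ Y Γ`).
* §2 `coe_holAt_cons`, `step_mul_eq`, ★★ `holRatio_eq_orderedProd` — `↑(holAt U Γ) * (↑(holAt U₀ Γ))^* = ((List.range |Γ|).map fun t ↦ 1 + Λ_t(Z^{ex})).prod`,
  `Z^{ex}_s = stepFactor U s * (stepFactor U₀ s)^* − 1`; `orderedProd_range_eq_ofFn` (= `(List.ofFn fun i : Fin |Γ| ↦ 1 + Λ_{↑i}).prod`, the letter of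
  ✓ `Prop7OrderedProductExpansion`), `sum_range_eq_sum_fin`, `commSum_range_eq_commSum_fin` (range-indexed ↔ `Fin`-indexed sums).  (The per-step quadratic remainder
  `‖Z^{ex}_s − covStep_s‖ ≤ ‖Y_{b(s)}‖²` is inside ✓ `Prop7HolRatioPerStep.norm_holRatio_bounds_perStep`; not restated.)
* §3 `letter_append_left`, `letter_append_right`, ★★ `letter_append_eq_finAppend` — `(fun i : Fin (|Γ₁|+|Γ₂|) ↦ Λ_{↑i}(Γ₁ ⧺ Γ₂)) = Fin.append (fun i ↦ Λ_{↑i}(Γ₁))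
  (fun i ↦ Ad_{U₀(Γ₁)}Λ_{↑i}(Γ₂))`; `commSum_conj` (`C(Ad_g A) = Ad_g C(A)`), `norm_commSum_conj_le`.
HONEST SCOPE.  Algebra of lists and holonomies, no estimate; the reversal law (`wordRev`) and the loop-word assembly are the sequel.

References: T. Bałaban, CMP 98 (1985) 17–51 [Balaban1985Averaging] ((56)–(58) p.27, (19)–(23) p.21); CMP 109 (1987) 249–301 [Balaban1987RG1] ((0.4) p.253).
-/

noncomputable section

open scoped BigOperators Matrix.Norms.L2Operator

namespace Summit.QuantumFields.YangMills.Theorems.Prop7WordLetters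

open Literature.MathematicalPhysics.QuantumFieldTheory.Balaban1983to89
open Finset T4Continuum BlockAveraging BlockAveragingEMLLinearised BlockAveragingEMLLinearisedBackground
open Summit.QuantumFields.YangMills.Theorems.Prop7HolRatioPerStep (norm_coe_eq_one norm_star_coe_eq_one coe_star_mul_self coe_mul_star_self
  stepFactor_mul_star' star_mul_stepFactor')

variable {P : Params} {n : Type*} [Fintype n] [DecidableEq n] [Nonempty n] {j : ℕ}

/-! ## §1 The letters of `s :: Γ`, and the letter sum is `covWalkSum` -/

/-- The head letter of `s :: Γ` is the bare step term `Z s` (empty prefix, trivial transport). [cite: Balaban1985Averaging, (58) p.27] -/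
theorem letter_cons_zero (U₀ : GaugeField P j (Matrix.specialUnitaryGroup n ℂ)) (Z : LStep P j → Matrix n n ℂ) (s : LStep P j) (Γ : List (LStep P j)) :
    ((holAt U₀ ((s :: Γ).take 0) : Matrix.specialUnitaryGroup n ℂ) : Matrix n n ℂ) * (((s :: Γ)[0]?).map Z).getD 0
        * star ((holAt U₀ ((s :: Γ).take 0) : Matrix.specialUnitaryGroup n ℂ) : Matrix n n ℂ) = Z s := by
  simp [holAt_nil]

/-- The `(t+1)`-st letter of `s :: Γ` is the `t`-th letter of `Γ` transported by the step factor `g_s`. [cite: Balaban1985Averaging, (58) p.27] -/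
theorem letter_cons_succ (U₀ : GaugeField P j (Matrix.specialUnitaryGroup n ℂ)) (Z : LStep P j → Matrix n n ℂ) (s : LStep P j) (Γ : List (LStep P j)) (t : ℕ) :
    ((holAt U₀ ((s :: Γ).take (t + 1)) : Matrix.specialUnitaryGroup n ℂ) : Matrix n n ℂ) * (((s :: Γ)[t + 1]?).map Z).getD 0
        * star ((holAt U₀ ((s :: Γ).take (t + 1)) : Matrix.specialUnitaryGroup n ℂ) : Matrix n n ℂ)
      = stepFactor U₀ s
        * (((holAt U₀ (Γ.take t) : Matrix.specialUnitaryGroup n ℂ) : Matrix n n ℂ) * ((Γ[t]?).map Z).getD 0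
            * star ((holAt U₀ (Γ.take t) : Matrix.specialUnitaryGroup n ℂ) : Matrix n n ℂ))
        * star (stepFactor U₀ s) := by
  rw [List.take_succ_cons, List.getElem?_cons_succ, coe_holAt_eq_prod_stepFactor, List.map_cons, List.prod_cons, ← coe_holAt_eq_prod_stepFactor, star_mul]
  noncomm_ring

/-- ★ **THE LETTER SUM OF THE FIRST-ORDER STEP TERMS IS THE COVARIANT SIGNED SUM OF RECORD**: `Σ_{t<|Γ|} U₀(Γ_{<t})·covStep_{U₀}(Y)(s_t)·U₀(Γ_{<t})^* = covWalkSum U₀ Y Γ`.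
[cite: Balaban1985Averaging, (58) p.27] -/
theorem sum_letter_eq_covWalkSum (U₀ : GaugeField P j (Matrix.specialUnitaryGroup n ℂ)) (Y : PBond P j → Matrix n n ℂ) :
    ∀ Γ : List (LStep P j),
      ∑ t ∈ Finset.range Γ.length,
          ((holAt U₀ (Γ.take t) : Matrix.specialUnitaryGroup n ℂ) : Matrix n n ℂ) * ((Γ[t]?).map (covStep U₀ Y)).getD 0
            * star ((holAt U₀ (Γ.take t) : Matrix.specialUnitaryGroup n ℂ) : Matrix n n ℂ)
        = covWalkSum U₀ Y Γ
  | [] => by simp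
  | s :: Γ => by
    rw [List.length_cons, Finset.sum_range_succ', letter_cons_zero, covWalkSum_cons, ← sum_letter_eq_covWalkSum U₀ Y Γ, Finset.mul_sum, Finset.sum_mul,
      add_comm]
    congr 1
    exact Finset.sum_congr rfl fun t _ => letter_cons_succ U₀ (covStep U₀ Y) s Γ t

/-! ## §2 The holonomy ratio is the ordered product of `1 +` the exact step letters -/

/-- `U(s·Γ) = u_s · U(Γ)` read in `M_N(ℂ)` (step factor split off). [cite: Balaban1985Averaging, (9) p.19] -/
theorem coe_holAt_cons (U : GaugeField P j (Matrix.specialUnitaryGroup n ℂ)) (s : LStep P j) (Γ : List (LStep P j)) :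
    ((holAt U (s :: Γ) : Matrix.specialUnitaryGroup n ℂ) : Matrix n n ℂ) = stepFactor U s * ((holAt U Γ : Matrix.specialUnitaryGroup n ℂ) : Matrix n n ℂ) := by
  rw [coe_holAt_eq_prod_stepFactor, List.map_cons, List.prod_cons, ← coe_holAt_eq_prod_stepFactor]

omit [Nonempty n] in
/-- One exact step: `u_s·(Ad_{g_s}M)… `: `u_s · M′ · g_s^* = (1 + (u_s g_s^* − 1)) · (g_s M′ g_s^*)`… in the form used below,
`u_s * X * star g_s = (1 + (u_s * star g_s - 1)) * (g_s * X * star g_s)` for the step factors of `U, U₀` (uses `g_s^* g_s = 1`). [cite: Balaban1985Averaging, (56) p.27] -/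
theorem step_mul_eq (U₀ U : GaugeField P j (Matrix.specialUnitaryGroup n ℂ)) (s : LStep P j) (X : Matrix n n ℂ) :
    stepFactor U s * X * star (stepFactor U₀ s) = (1 + (stepFactor U s * star (stepFactor U₀ s) - 1)) * (stepFactor U₀ s * X * star (stepFactor U₀ s)) := by
  have h := star_mul_stepFactor' U₀ s
  calc stepFactor U s * X * star (stepFactor U₀ s)
      = stepFactor U s * (star (stepFactor U₀ s) * stepFactor U₀ s) * X * star (stepFactor U₀ s) := by rw [h, mul_one]
    _ = (1 + (stepFactor U s * star (stepFactor U₀ s) - 1)) * (stepFactor U₀ s * X * star (stepFactor U₀ s)) := by noncomm_ring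

/-- ★★ **THE HOLONOMY RATIO IS THE ORDERED PRODUCT OF THE TRANSPORTED EXACT STEP LETTERS**: with `Z^{ex}_s := u_s·g_s^* − 1`,
`U(Γ)·U₀(Γ)^* = Π_{t<|Γ|} (1 + U₀(Γ_{<t})·Z^{ex}_{s_t}·U₀(Γ_{<t})^*)` (ordered, first step leftmost). [cite: Balaban1985Averaging, (56)-(58) p.27] -/
theorem holRatio_eq_orderedProd (U₀ U : GaugeField P j (Matrix.specialUnitaryGroup n ℂ)) :
    ∀ Γ : List (LStep P j),
      ((holAt U Γ : Matrix.specialUnitaryGroup n ℂ) : Matrix n n ℂ) * star ((holAt U₀ Γ : Matrix.specialUnitaryGroup n ℂ) : Matrix n n ℂ)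
        = ((List.range Γ.length).map fun t =>
            1 + ((holAt U₀ (Γ.take t) : Matrix.specialUnitaryGroup n ℂ) : Matrix n n ℂ)
                  * ((Γ[t]?).map fun s => stepFactor U s * star (stepFactor U₀ s) - 1).getD 0
                  * star ((holAt U₀ (Γ.take t) : Matrix.specialUnitaryGroup n ℂ) : Matrix n n ℂ)).prod
  | [] => by simp [holAt_nil]
  | s :: Γ => by
    rw [List.length_cons, List.range_succ_eq_map, List.map_cons, List.prod_cons, List.map_map, letter_cons_zero]
    -- the tail product is `Ad_{g_s}` of the product for `Γ`
    have htail : ((List.range Γ.length).map ((fun t =>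
            1 + ((holAt U₀ ((s :: Γ).take t) : Matrix.specialUnitaryGroup n ℂ) : Matrix n n ℂ)
                  * (((s :: Γ)[t]?).map fun s => stepFactor U s * star (stepFactor U₀ s) - 1).getD 0
                  * star ((holAt U₀ ((s :: Γ).take t) : Matrix.specialUnitaryGroup n ℂ) : Matrix n n ℂ)) ∘ Nat.succ)).prod
        = stepFactor U₀ s
          * ((List.range Γ.length).map fun t =>
              1 + ((holAt U₀ (Γ.take t) : Matrix.specialUnitaryGroup n ℂ) : Matrix n n ℂ)
                    * ((Γ[t]?).map fun s => stepFactor U s * star (stepFactor U₀ s) - 1).getD 0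
                    * star ((holAt U₀ (Γ.take t) : Matrix.specialUnitaryGroup n ℂ) : Matrix n n ℂ)).prod
          * star (stepFactor U₀ s) := by
      have hconj : ∀ (l : List (Matrix n n ℂ)),
          (l.map fun X => 1 + stepFactor U₀ s * X * star (stepFactor U₀ s)).prod = stepFactor U₀ s * (l.map fun X => 1 + X).prod * star (stepFactor U₀ s) := by
        intro l
        induction l with
        | nil => simp [stepFactor_mul_star']
        | cons X l ih =>
          rw [List.map_cons, List.prod_cons, List.map_cons, List.prod_cons, ih]
          have h1 := star_mul_stepFactor' U₀ s
          calc (1 + stepFactor U₀ s * X * star (stepFactor U₀ s)) * (stepFactor U₀ s * (List.map (fun X => 1 + X) l).prod * star (stepFactor U₀ s))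
              = stepFactor U₀ s * (List.map (fun X => 1 + X) l).prod * star (stepFactor U₀ s)
                + stepFactor U₀ s * X * (star (stepFactor U₀ s) * stepFactor U₀ s) * (List.map (fun X => 1 + X) l).prod * star (stepFactor U₀ s) := by
                  noncomm_ring
            _ = stepFactor U₀ s * ((1 + X) * (List.map (fun X => 1 + X) l).prod) * star (stepFactor U₀ s) := by rw [h1]; noncomm_ring
      have hL : (List.range Γ.length).map ((fun t =>
            1 + ((holAt U₀ ((s :: Γ).take t) : Matrix.specialUnitaryGroup n ℂ) : Matrix n n ℂ)
                  * (((s :: Γ)[t]?).map fun s => stepFactor U s * star (stepFactor U₀ s) - 1).getD 0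
                  * star ((holAt U₀ ((s :: Γ).take t) : Matrix.specialUnitaryGroup n ℂ) : Matrix n n ℂ)) ∘ Nat.succ)
          = ((List.range Γ.length).map fun t =>
              ((holAt U₀ (Γ.take t) : Matrix.specialUnitaryGroup n ℂ) : Matrix n n ℂ)
                * ((Γ[t]?).map fun s => stepFactor U s * star (stepFactor U₀ s) - 1).getD 0
                * star ((holAt U₀ (Γ.take t) : Matrix.specialUnitaryGroup n ℂ) : Matrix n n ℂ)).map
            (fun X => 1 + stepFactor U₀ s * X * star (stepFactor U₀ s)) := by
        rw [List.map_map]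
        refine List.map_congr_left fun t _ => ?_
        simp only [Function.comp_apply, Nat.succ_eq_add_one, letter_cons_succ]
      have hR : ((List.range Γ.length).map fun t =>
              1 + ((holAt U₀ (Γ.take t) : Matrix.specialUnitaryGroup n ℂ) : Matrix n n ℂ)
                    * ((Γ[t]?).map fun s => stepFactor U s * star (stepFactor U₀ s) - 1).getD 0
                    * star ((holAt U₀ (Γ.take t) : Matrix.specialUnitaryGroup n ℂ) : Matrix n n ℂ))
          = ((List.range Γ.length).map fun t =>
              ((holAt U₀ (Γ.take t) : Matrix.specialUnitaryGroup n ℂ) : Matrix n n ℂ)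
                * ((Γ[t]?).map fun s => stepFactor U s * star (stepFactor U₀ s) - 1).getD 0
                * star ((holAt U₀ (Γ.take t) : Matrix.specialUnitaryGroup n ℂ) : Matrix n n ℂ)).map (fun X => 1 + X) := by
        rw [List.map_map]; rfl
      rw [hL, hR, hconj]
    rw [htail, coe_holAt_cons, coe_holAt_cons, star_mul, ← holRatio_eq_orderedProd U₀ U Γ]
    calc stepFactor U s * ((holAt U Γ : Matrix.specialUnitaryGroup n ℂ) : Matrix n n ℂ)
          * (star ((holAt U₀ Γ : Matrix.specialUnitaryGroup n ℂ) : Matrix n n ℂ) * star (stepFactor U₀ s))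
        = stepFactor U s * (((holAt U Γ : Matrix.specialUnitaryGroup n ℂ) : Matrix n n ℂ) * star ((holAt U₀ Γ : Matrix.specialUnitaryGroup n ℂ) : Matrix n n ℂ))
          * star (stepFactor U₀ s) := by noncomm_ring
      _ = _ := step_mul_eq U₀ U s _

omit [Nonempty n] in
/-- The ordered product over `List.range m` is the `List.ofFn` product of ✓ `Prop7OrderedProductExpansion` (index read as a `Fin m`). [folklore] -/
theorem orderedProd_range_eq_ofFn (m : ℕ) (A : ℕ → Matrix n n ℂ) :
    ((List.range m).map fun t => 1 + A t).prod = (List.ofFn fun i : Fin m => 1 + A i).prod := by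
  rw [List.ofFn_eq_map, ← List.map_coe_finRange_eq_range, List.map_map]
  rfl

omit [Fintype n] [DecidableEq n] [Nonempty n] in
/-- A sum over `Finset.range m` is the `Fin m`-sum of ✓ `Prop7OrderedProductExpansion`'s letters. [folklore] -/
theorem sum_range_eq_sum_fin (m : ℕ) (A : ℕ → Matrix n n ℂ) :
    ∑ t ∈ Finset.range m, A t = ∑ i : Fin m, A i :=
  (Fin.sum_univ_eq_sum_range A m).symm

omit [DecidableEq n] [Nonempty n] in
/-- The ordered commutator pair sum over `Finset.range m` (condition `t < t′` on naturals) is the `Fin m`-indexed one of ✓ `Prop7OrderedProductExpansion`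
(condition `i < i′` on `Fin m`). [folklore] -/
theorem commSum_range_eq_commSum_fin (m : ℕ) (A : ℕ → Matrix n n ℂ) :
    (∑ t ∈ Finset.range m, ∑ t' ∈ Finset.range m, if t < t' then A t * A t' - A t' * A t else 0)
      = ∑ i : Fin m, ∑ i' : Fin m, if i < i' then A i * A i' - A i' * A i else 0 := by
  rw [← Fin.sum_univ_eq_sum_range]
  refine Finset.sum_congr rfl fun i _ => ?_
  rw [← Fin.sum_univ_eq_sum_range]
  refine Finset.sum_congr rfl fun i' _ => ?_
  simp only [Fin.lt_def]

/-! ## §3 Concatenation of walks is `Fin.append` of letter families; conjugation covariance of the commutator sum -/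

/-- The letters of `Γ₁ ⧺ Γ₂` on the first block are the letters of `Γ₁`. [cite: Balaban1985Averaging, (58) p.27] -/
theorem letter_append_left (U₀ : GaugeField P j (Matrix.specialUnitaryGroup n ℂ)) (Z : LStep P j → Matrix n n ℂ) (Γ₁ Γ₂ : List (LStep P j))
    {t : ℕ} (ht : t < Γ₁.length) :
    ((holAt U₀ ((Γ₁ ++ Γ₂).take t) : Matrix.specialUnitaryGroup n ℂ) : Matrix n n ℂ) * (((Γ₁ ++ Γ₂)[t]?).map Z).getD 0
        * star ((holAt U₀ ((Γ₁ ++ Γ₂).take t) : Matrix.specialUnitaryGroup n ℂ) : Matrix n n ℂ)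
      = ((holAt U₀ (Γ₁.take t) : Matrix.specialUnitaryGroup n ℂ) : Matrix n n ℂ) * ((Γ₁[t]?).map Z).getD 0
        * star ((holAt U₀ (Γ₁.take t) : Matrix.specialUnitaryGroup n ℂ) : Matrix n n ℂ) := by
  rw [List.take_append_of_le_length ht.le, List.getElem?_append_left ht]

/-- The letters of `Γ₁ ⧺ Γ₂` on the second block are the letters of `Γ₂` transported by `U₀(Γ₁)`. [cite: Balaban1985Averaging, (58) p.27] -/
theorem letter_append_right (U₀ : GaugeField P j (Matrix.specialUnitaryGroup n ℂ)) (Z : LStep P j → Matrix n n ℂ) (Γ₁ Γ₂ : List (LStep P j)) (u : ℕ) :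
    ((holAt U₀ ((Γ₁ ++ Γ₂).take (Γ₁.length + u)) : Matrix.specialUnitaryGroup n ℂ) : Matrix n n ℂ) * (((Γ₁ ++ Γ₂)[Γ₁.length + u]?).map Z).getD 0
        * star ((holAt U₀ ((Γ₁ ++ Γ₂).take (Γ₁.length + u)) : Matrix.specialUnitaryGroup n ℂ) : Matrix n n ℂ)
      = ((holAt U₀ Γ₁ : Matrix.specialUnitaryGroup n ℂ) : Matrix n n ℂ)
        * (((holAt U₀ (Γ₂.take u) : Matrix.specialUnitaryGroup n ℂ) : Matrix n n ℂ) * ((Γ₂[u]?).map Z).getD 0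
            * star ((holAt U₀ (Γ₂.take u) : Matrix.specialUnitaryGroup n ℂ) : Matrix n n ℂ))
        * star ((holAt U₀ Γ₁ : Matrix.specialUnitaryGroup n ℂ) : Matrix n n ℂ) := by
  rw [List.take_append, List.take_of_length_le (Nat.le_add_right _ _), List.getElem?_append_right (Nat.le_add_right _ _), Nat.add_sub_cancel_left,
    holAt_append, Submonoid.coe_mul, star_mul]
  noncomm_ring

/-- ★★ **CONCATENATION IS `Fin.append`**: read on `Fin (|Γ₁| + |Γ₂|)`, the letter family of `Γ₁ ⧺ Γ₂` is `Fin.append` of the letter family of `Γ₁` and the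
`U₀(Γ₁)`-transported letter family of `Γ₂` — so ✓ `Prop7OrderedProductExpansion.commSum_append` and ✓ `Prop7WordCommutatorSplit.commSum_threePiece` apply to
concatenated walks literally. [cite: Balaban1985Averaging, (58) p.27; Balaban1987RG1, (0.4) p.253] -/
theorem letter_append_eq_finAppend (U₀ : GaugeField P j (Matrix.specialUnitaryGroup n ℂ)) (Z : LStep P j → Matrix n n ℂ) (Γ₁ Γ₂ : List (LStep P j)) :
    (fun i : Fin (Γ₁.length + Γ₂.length) =>
        ((holAt U₀ ((Γ₁ ++ Γ₂).take i) : Matrix.specialUnitaryGroup n ℂ) : Matrix n n ℂ) * (((Γ₁ ++ Γ₂)[(i : ℕ)]?).map Z).getD 0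
          * star ((holAt U₀ ((Γ₁ ++ Γ₂).take i) : Matrix.specialUnitaryGroup n ℂ) : Matrix n n ℂ))
      = Fin.append
          (fun i : Fin Γ₁.length =>
            ((holAt U₀ (Γ₁.take i) : Matrix.specialUnitaryGroup n ℂ) : Matrix n n ℂ) * ((Γ₁[(i : ℕ)]?).map Z).getD 0
              * star ((holAt U₀ (Γ₁.take i) : Matrix.specialUnitaryGroup n ℂ) : Matrix n n ℂ))
          (fun u : Fin Γ₂.length =>
            ((holAt U₀ Γ₁ : Matrix.specialUnitaryGroup n ℂ) : Matrix n n ℂ)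
              * (((holAt U₀ (Γ₂.take u) : Matrix.specialUnitaryGroup n ℂ) : Matrix n n ℂ) * ((Γ₂[(u : ℕ)]?).map Z).getD 0
                  * star ((holAt U₀ (Γ₂.take u) : Matrix.specialUnitaryGroup n ℂ) : Matrix n n ℂ))
              * star ((holAt U₀ Γ₁ : Matrix.specialUnitaryGroup n ℂ) : Matrix n n ℂ)) := by
  funext i
  refine Fin.addCases (fun i₁ => ?_) (fun u => ?_) i
  · rw [Fin.append_left, Fin.val_castAdd, letter_append_left U₀ Z Γ₁ Γ₂ i₁.isLt]
  · rw [Fin.append_right, Fin.val_natAdd, letter_append_right]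

omit [Nonempty n] in
/-- **THE COMMUTATOR PAIR SUM IS CONJUGATION-COVARIANT**: `C(Ad_g A) = Ad_g C(A)` for `g ∈ SU(N)` (so the transported blocks of a concatenation contribute
`Ad`-conjugates of their own commutator sums, with the same norm). [folklore] -/
theorem commSum_conj {m : ℕ} (g : Matrix.specialUnitaryGroup n ℂ) (A : Fin m → Matrix n n ℂ) :
    (∑ i : Fin m, ∑ i' : Fin m,
        if i < i' then ((g : Matrix n n ℂ) * A i * star (g : Matrix n n ℂ)) * ((g : Matrix n n ℂ) * A i' * star (g : Matrix n n ℂ))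
          - ((g : Matrix n n ℂ) * A i' * star (g : Matrix n n ℂ)) * ((g : Matrix n n ℂ) * A i * star (g : Matrix n n ℂ)) else 0)
      = (g : Matrix n n ℂ) * (∑ i : Fin m, ∑ i' : Fin m, if i < i' then A i * A i' - A i' * A i else 0) * star (g : Matrix n n ℂ) := by
  have hg : star (g : Matrix n n ℂ) * (g : Matrix n n ℂ) = 1 := coe_star_mul_self g
  have key : ∀ X Y : Matrix n n ℂ,
      ((g : Matrix n n ℂ) * X * star (g : Matrix n n ℂ)) * ((g : Matrix n n ℂ) * Y * star (g : Matrix n n ℂ)) = (g : Matrix n n ℂ) * (X * Y) * star (g : Matrix n n ℂ) := by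
    intro X Y
    calc _ = (g : Matrix n n ℂ) * X * (star (g : Matrix n n ℂ) * (g : Matrix n n ℂ)) * Y * star (g : Matrix n n ℂ) := by noncomm_ring
      _ = _ := by rw [hg]; noncomm_ring
  rw [Finset.mul_sum, Finset.sum_mul]
  refine Finset.sum_congr rfl fun i _ => ?_
  rw [Finset.mul_sum, Finset.sum_mul]
  refine Finset.sum_congr rfl fun i' _ => ?_
  by_cases h : i < i'
  · rw [if_pos h, if_pos h, key, key, mul_sub, sub_mul]
  · rw [if_neg h, if_neg h, mul_zero, zero_mul]

/-- Norm form: `‖C(Ad_g A)‖ ≤ ‖C(A)‖`. [folklore] -/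
theorem norm_commSum_conj_le {m : ℕ} (g : Matrix.specialUnitaryGroup n ℂ) (A : Fin m → Matrix n n ℂ) :
    ‖∑ i : Fin m, ∑ i' : Fin m,
        if i < i' then ((g : Matrix n n ℂ) * A i * star (g : Matrix n n ℂ)) * ((g : Matrix n n ℂ) * A i' * star (g : Matrix n n ℂ))
          - ((g : Matrix n n ℂ) * A i' * star (g : Matrix n n ℂ)) * ((g : Matrix n n ℂ) * A i * star (g : Matrix n n ℂ)) else 0‖
      ≤ ‖∑ i : Fin m, ∑ i' : Fin m, if i < i' then A i * A i' - A i' * A i else 0‖ := by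
  rw [commSum_conj]
  calc _ ≤ ‖(g : Matrix n n ℂ)‖ * ‖∑ i : Fin m, ∑ i' : Fin m, if i < i' then A i * A i' - A i' * A i else 0‖ * ‖star (g : Matrix n n ℂ)‖ :=
        (norm_mul_le _ _).trans (mul_le_mul_of_nonneg_right (norm_mul_le _ _) (norm_nonneg _))
    _ = _ := by rw [norm_coe_eq_one, norm_star_coe_eq_one, one_mul, mul_one]

end Summit.QuantumFields.YangMills.Theorems.Prop7WordLetters

end
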